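import Summits.Ventures.HodgeRepro.FaceCensusEngine

/-!
# EngineMasks — generic facts about the face-census engine, part 1 (seat p4, blind cell pub-hodge-repro)

Structural lemmas about the sealer's `FaceCensusEngine` for an ARBITRARY Cayley table `Γ`:
bits of image masks / flips / places, the group axioms unpacked from `isCMGaloisType`, conjugate
types, CM types, membership in `places`, `cmTypes`, `faces`.  Part 2 (`EngineFaces.lean`) derives
`sumTwo`, `cornersWF`, `noConjugateCorners` for every face.  No per-row computation here.  Kit v4: no auxiliary
definitions anywhere in the kit — the group axioms are used through the hypothesis `Γ.isCMGaloisType = true` and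
the theorems `IsGroupTable.mul_assoc hΓ`, … (this file), so that every file of the kit is a pure proof file.
-/

namespace Summit.Ventures.HodgeRepro.FaceCensus

/-! ### Bits of masks -/

section Masks

variable {n : ℕ}

/-- Bit `i` of the singleton mask `bit j` is `decide (i = j)`. -/
theorem mem_bit (i j : Fin n) : mem i (bit j) = decide (i = j) := by
  simp only [mem, bit, Nat.testBit_two_pow]
  rw [decide_eq_decide]
  exact ⟨fun h => Fin.ext h.symm, fun h => (Fin.ext_iff.1 h).symm⟩

/-- Bit `i` of a bitwise `or` is the `or` of the bits. -/
theorem mem_or (i : Fin n) (S T : ℕ) : mem i (S ||| T) = (mem i S || mem i T) :=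
  Nat.testBit_or _ _ _

/-- Bit `i` of a bitwise `xor` is the `xor` of the bits. -/
theorem mem_xor (i : Fin n) (S T : ℕ) : mem i (S ^^^ T) = (mem i S ^^ mem i T) :=
  Nat.testBit_xor _ _ _

/-- Bit `i` of the flip `flipAt π T = T ^^^ π` is `mem i T ^^ mem i π`. -/
theorem mem_flipAt (i : Fin n) (π T : ℕ) : mem i (flipAt π T) = (mem i T ^^ mem i π) :=
  Nat.testBit_xor _ _ _

/-- The zero mask has no bits. -/
theorem mem_zero (i : Fin n) : mem i 0 = false := Nat.zero_testBit _

/-- Invariant of the `foldl` computing an image mask. -/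
theorem mem_foldl_image (f : Fin n → Fin n) (T : ℕ) (i : Fin n) (L : List (Fin n)) (acc : ℕ) :
    mem i (L.foldl (fun acc j => if mem j T then acc ||| bit (f j) else acc) acc) =
      (mem i acc || L.any fun j => mem j T && decide (f j = i)) := by
  induction L generalizing acc with
  | nil => simp
  | cons j L ih =>
    simp only [List.foldl_cons, List.any_cons]
    rw [ih]
    by_cases h : mem j T = true
    · simp [h, mem_or, mem_bit, Bool.or_assoc, eq_comm]
    · simp [h]

/-- Bit `i` of `imageMask f T` is set iff some `j` with bit `j` of `T` set has `f j = i` (as a `Bool` `any`). -/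
theorem mem_imageMask (f : Fin n → Fin n) (T : ℕ) (i : Fin n) :
    mem i (imageMask f T) = (List.finRange n).any fun j => mem j T && decide (f j = i) := by
  unfold imageMask
  rw [mem_foldl_image, mem_zero, Bool.false_or]

/-- Bit `i` of `imageMask f T` is set iff `i = f j` for some `j` with bit `j` of `T` set. -/
theorem mem_imageMask_iff (f : Fin n → Fin n) (T : ℕ) (i : Fin n) :
    mem i (imageMask f T) = true ↔ ∃ j, mem j T = true ∧ f j = i := by
  simp [mem_imageMask, List.any_eq_true, List.mem_finRange]

/-- For an injective `f`, the bit `f j` of the image mask is the bit `j` of the source. -/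
theorem mem_imageMask_of_injective {f : Fin n → Fin n} (hf : Function.Injective f) (T : ℕ)
    (j : Fin n) : mem (f j) (imageMask f T) = mem j T := by
  by_cases h : mem j T = true
  · rw [h]; exact (mem_imageMask_iff f T (f j)).2 ⟨j, h, rfl⟩
  · rw [Bool.not_eq_true] at h
    rw [h]
    rw [Bool.eq_false_iff]
    intro h'
    obtain ⟨k, hk, hkj⟩ := (mem_imageMask_iff f T (f j)).1 h'
    rw [hf hkj] at hk
    rw [hk] at h
    exact absurd h (by decide)

/-- Two masks below `2 ^ n` with the same bits on `Fin n` are equal. -/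
theorem eq_of_mem_eq {S T : ℕ} (hS : S < 2 ^ n) (hT : T < 2 ^ n) (h : ∀ i : Fin n, mem i S = mem i T) :
    S = T := by
  apply Nat.eq_of_testBit_eq
  intro k
  by_cases hk : k < n
  · exact h ⟨k, hk⟩
  · rw [Nat.testBit_eq_false_of_lt (lt_of_lt_of_le hS (Nat.pow_le_pow_right two_pos (not_lt.1 hk))),
      Nat.testBit_eq_false_of_lt (lt_of_lt_of_le hT (Nat.pow_le_pow_right two_pos (not_lt.1 hk)))]

/-- The singleton mask `bit i` is below `2 ^ n`. -/
theorem bit_lt (i : Fin n) : bit i < 2 ^ n := Nat.pow_lt_pow_right (by norm_num) i.2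

/-- The `foldl` computing an image mask stays below `2 ^ n` when its accumulator does. -/
theorem foldl_image_lt (f : Fin n → Fin n) (T : ℕ) (L : List (Fin n)) (acc : ℕ) (hacc : acc < 2 ^ n) :
    L.foldl (fun acc j => if mem j T then acc ||| bit (f j) else acc) acc < 2 ^ n := by
  induction L generalizing acc with
  | nil => simpa
  | cons j L ih =>
    simp only [List.foldl_cons]
    apply ih
    split_ifs
    · exact Nat.or_lt_two_pow hacc (bit_lt _)
    · exact hacc

/-- An image mask is below `2 ^ n`. -/
theorem imageMask_lt (f : Fin n → Fin n) (T : ℕ) : imageMask f T < 2 ^ n :=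
  foldl_image_lt f T _ 0 (Nat.two_pow_pos n)

/-- A flip of a mask below `2 ^ n` at a place below `2 ^ n` is below `2 ^ n`. -/
theorem flipAt_lt {π T : ℕ} (hπ : π < 2 ^ n) (hT : T < 2 ^ n) : flipAt π T < 2 ^ n :=
  Nat.xor_lt_two_pow hT hπ

/-! ### Sorted lists -/

/-- Membership in the sorted insertion `insertNat a l`: `x = a` or `x ∈ l`. -/
theorem mem_insertNat (a x : ℕ) (l : List ℕ) : x ∈ insertNat a l ↔ x = a ∨ x ∈ l := by
  induction l with
  | nil => simp [insertNat]
  | cons b l ih =>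
    simp only [insertNat]
    split_ifs
    · simp
    · simp only [List.mem_cons, ih]
      tauto

/-- `sortNat` preserves membership. -/
theorem mem_sortNat (x : ℕ) (l : List ℕ) : x ∈ sortNat l ↔ x ∈ l := by
  induction l with
  | nil => simp [sortNat]
  | cons a l ih => simp [sortNat, mem_insertNat, ih]

/-- `normalize` (sort, then erase duplicates) preserves membership. -/
theorem mem_normalize (x : ℕ) (l : List ℕ) : x ∈ normalize l ↔ x ∈ l := by
  simp [normalize, List.mem_eraseDups, mem_sortNat]

end Masks

namespace CMGaloisType

variable {n : ℕ} (Γ : CMGaloisType n)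

/-! ### Unpacking the `Bool` group axioms -/

namespace IsGroupTable

variable {Γ} (hΓ : Γ.isCMGaloisType = true)
include hΓ

/-- The `Bool` check `isCMGaloisType` unpacks to the group axioms: associativity, the two unit laws, right inverses,
`conj` central, `conj` an involution, `conj ≠ 1`. -/
theorem unpack :
    (∀ i j k, Γ.mul (Γ.mul i j) k = Γ.mul i (Γ.mul j k)) ∧ (∀ i, Γ.mul Γ.one i = i) ∧ (∀ i, Γ.mul i Γ.one = i) ∧
      (∀ i, ∃ j, Γ.mul i j = Γ.one) ∧ (∀ i, Γ.mul Γ.conj i = Γ.mul i Γ.conj) ∧ Γ.mul Γ.conj Γ.conj = Γ.one ∧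
      Γ.conj ≠ Γ.one := by
  simp only [isCMGaloisType, Bool.and_eq_true, List.all_eq_true, List.any_eq_true, List.mem_finRange,
    true_and, true_implies, beq_iff_eq, Bool.not_eq_eq_eq_not, Bool.not_true, beq_eq_false_iff_ne, ne_eq] at hΓ
  obtain ⟨⟨⟨⟨⟨h1, h2⟩, h3⟩, h4⟩, h5⟩, h6⟩ := hΓ
  exact ⟨h1, fun i => (h2 i).1, fun i => (h2 i).2, h3, h4, h5, h6⟩

/-- Associativity of the Cayley table. -/
theorem mul_assoc (i j k : Fin n) : Γ.mul (Γ.mul i j) k = Γ.mul i (Γ.mul j k) := (unpack hΓ).1 i j k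

/-- `one` is a left unit. -/
theorem one_mul (i : Fin n) : Γ.mul Γ.one i = i := (unpack hΓ).2.1 i

/-- `one` is a right unit. -/
theorem mul_one (i : Fin n) : Γ.mul i Γ.one = i := (unpack hΓ).2.2.1 i

/-- Every element has a right inverse. -/
theorem exists_right_inv (i : Fin n) : ∃ j, Γ.mul i j = Γ.one := (unpack hΓ).2.2.2.1 i

/-- `conj` is central. -/
theorem conj_comm (i : Fin n) : Γ.mul Γ.conj i = Γ.mul i Γ.conj := (unpack hΓ).2.2.2.2.1 i

/-- `conj` is an involution. -/
theorem conj_conj : Γ.mul Γ.conj Γ.conj = Γ.one := (unpack hΓ).2.2.2.2.2.1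

/-- `conj ≠ 1`. -/
theorem conj_ne_one : Γ.conj ≠ Γ.one := (unpack hΓ).2.2.2.2.2.2

/-- In a group table a right inverse is also a left inverse. -/
theorem right_inv_left {j j' : Fin n} (h : Γ.mul j j' = Γ.one) : Γ.mul j' j = Γ.one := by
  obtain ⟨j'', h''⟩ := (IsGroupTable.exists_right_inv hΓ) j'
  have : j'' = j := by
    calc j'' = Γ.mul Γ.one j'' := ((IsGroupTable.one_mul hΓ) _).symm
      _ = Γ.mul (Γ.mul j j') j'' := by rw [h]
      _ = Γ.mul j (Γ.mul j' j'') := (IsGroupTable.mul_assoc hΓ) _ _ _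
      _ = j := by rw [h'', (IsGroupTable.mul_one hΓ)]
  rw [← this]; exact h''

/-- Right multiplication by a fixed element is injective. -/
theorem mul_right_injective (j : Fin n) : Function.Injective fun i => Γ.mul i j := by
  intro a b hab
  obtain ⟨j', hj'⟩ := (IsGroupTable.exists_right_inv hΓ) j
  have : ∀ i, Γ.mul (Γ.mul i j) j' = i := fun i => by rw [(IsGroupTable.mul_assoc hΓ), hj', (IsGroupTable.mul_one hΓ)]
  rw [← this a, ← this b]
  simp only at hab
  rw [hab]

/-- Left multiplication by a fixed element is injective. -/
theorem mul_left_injective (j : Fin n) : Function.Injective fun i => Γ.mul j i := by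
  intro a b hab
  obtain ⟨j', hj'⟩ := (IsGroupTable.exists_right_inv hΓ) j
  have hj'' := (IsGroupTable.right_inv_left hΓ) hj'
  have : ∀ i, Γ.mul j' (Γ.mul j i) = i := fun i => by rw [← (IsGroupTable.mul_assoc hΓ), hj'', (IsGroupTable.one_mul hΓ)]
  rw [← this a, ← this b]
  simp only at hab
  rw [hab]

/-- `conj` is an involution: `conj * (conj * i) = i`. -/
theorem conj_mul_conj_mul (i : Fin n) : Γ.mul Γ.conj (Γ.mul Γ.conj i) = i := by
  rw [← (IsGroupTable.mul_assoc hΓ), (IsGroupTable.conj_conj hΓ), (IsGroupTable.one_mul hΓ)]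

/-- `conj * i = j ↔ i = conj * j`. -/
theorem conj_mul_eq_iff (i j : Fin n) : Γ.mul Γ.conj i = j ↔ i = Γ.mul Γ.conj j := by
  constructor
  · rintro rfl; rw [(IsGroupTable.conj_mul_conj_mul hΓ)]
  · rintro rfl; rw [(IsGroupTable.conj_mul_conj_mul hΓ)]

/-- `conj * i ≠ i`, because `conj ≠ 1`. -/
theorem conj_mul_ne (i : Fin n) : Γ.mul Γ.conj i ≠ i := by
  intro h
  have h1 : Γ.mul Γ.conj i = Γ.mul Γ.one i := by rw [h, (IsGroupTable.one_mul hΓ)]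
  exact (IsGroupTable.conj_ne_one hΓ) ((IsGroupTable.mul_right_injective hΓ) i h1)

end IsGroupTable

/-! ### Conjugate types, places, CM types -/

/-- Bit `i` of the conjugate type `bar T = conj · T` is bit `conj * i` of `T`. -/
theorem mem_bar (hΓ : Γ.isCMGaloisType = true) (T : ℕ) (i : Fin n) :
    mem i (Γ.bar T) = mem (Γ.mul Γ.conj i) T := by
  have := mem_imageMask_of_injective ((IsGroupTable.mul_left_injective hΓ) Γ.conj) T (Γ.mul Γ.conj i)
  simp only [(IsGroupTable.conj_mul_conj_mul hΓ)] at this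
  exact this

/-- Bit `i * j` of the twist `twist j T = T · j` is bit `i` of `T`. -/
theorem mem_twist (hΓ : Γ.isCMGaloisType = true) (j : Fin n) (T : ℕ) (i : Fin n) :
    mem (Γ.mul i j) (Γ.twist j T) = mem i T :=
  mem_imageMask_of_injective ((IsGroupTable.mul_right_injective hΓ) j) T i

/-- `isCMType T` unpacked: `T < 2 ^ n` and, for every `i`, the bit at `conj * i` is the negation of the bit at `i` (exactly one of each conjugate pair). -/
theorem isCMType_iff (T : ℕ) :
    Γ.isCMType T = true ↔ T < 2 ^ n ∧ ∀ i : Fin n, mem (Γ.mul Γ.conj i) T = !mem i T := by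
  simp only [isCMType, Bool.and_eq_true, decide_eq_true_eq, List.all_eq_true, List.mem_finRange, true_imp_iff,
    bne_iff_ne, ne_eq]
  constructor
  · rintro ⟨h1, h2⟩
    refine ⟨h1, fun i => ?_⟩
    have := h2 i
    cases h : mem i T <;> cases h' : mem (Γ.mul Γ.conj i) T <;> simp_all
  · rintro ⟨h1, h2⟩
    exact ⟨h1, fun i => by rw [h2 i]; cases mem i T <;> simp⟩

/-- For a CM type, the bit at `conj * i` is the negation of the bit at `i`. -/
theorem mem_conj_of_isCMType {T : ℕ} (hT : Γ.isCMType T = true) (i : Fin n) :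
    mem (Γ.mul Γ.conj i) T = !mem i T := ((Γ.isCMType_iff T).1 hT).2 i

/-- A CM type is a mask below `2 ^ n`. -/
theorem lt_of_isCMType {T : ℕ} (hT : Γ.isCMType T = true) : T < 2 ^ n := ((Γ.isCMType_iff T).1 hT).1

/-- For a CM type `T`, the conjugate type `bar T` is the complement of `T` bitwise. -/
theorem mem_bar_of_isCMType (hΓ : Γ.isCMGaloisType = true) {T : ℕ} (hT : Γ.isCMType T = true) (i : Fin n) :
    mem i (Γ.bar T) = !mem i T := by
  rw [Γ.mem_bar hΓ, Γ.mem_conj_of_isCMType hT]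

/-- Bit `i` of the place `placeMask a = {a, conj * a}`. -/
theorem mem_placeMask (a i : Fin n) :
    mem i (Γ.placeMask a) = (decide (i = a) || decide (i = Γ.mul Γ.conj a)) := by
  simp [placeMask, mem_or, mem_bit]

/-- A place mask is below `2 ^ n`. -/
theorem placeMask_lt (a : Fin n) : Γ.placeMask a < 2 ^ n :=
  Nat.or_lt_two_pow (bit_lt _) (bit_lt _)

/-- The place of `conj * a` is the place of `a`. -/
theorem placeMask_conj (hΓ : Γ.isCMGaloisType = true) (a : Fin n) :
    Γ.placeMask (Γ.mul Γ.conj a) = Γ.placeMask a := by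
  simp only [placeMask, (IsGroupTable.conj_mul_conj_mul hΓ)]
  exact Nat.lor_comm _ _

/-- A place is determined by any of its two members. -/
theorem placeMask_eq_of_mem (hΓ : Γ.isCMGaloisType = true) {a i : Fin n} (h : mem i (Γ.placeMask a) = true) :
    Γ.placeMask i = Γ.placeMask a := by
  rw [Γ.mem_placeMask, Bool.or_eq_true, decide_eq_true_eq, decide_eq_true_eq] at h
  rcases h with rfl | rfl
  · rfl
  · exact Γ.placeMask_conj hΓ a

/-- Places are conjugation-stable. -/
theorem mem_conj_placeMask (hΓ : Γ.isCMGaloisType = true) (a i : Fin n) :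
    mem (Γ.mul Γ.conj i) (Γ.placeMask a) = mem i (Γ.placeMask a) := by
  simp only [Γ.mem_placeMask, (IsGroupTable.conj_mul_eq_iff hΓ)]
  rw [(IsGroupTable.conj_mul_conj_mul hΓ), Bool.or_comm]

/-- Membership in `places`: the place masks `placeMask a`, `a : Fin n`. -/
theorem mem_places (p : ℕ) : p ∈ Γ.places ↔ ∃ a, p = Γ.placeMask a := by
  simp [places, mem_normalize, List.mem_map, List.mem_finRange, eq_comm]

/-- Membership in `cmTypes` is the `Bool` predicate `isCMType`. -/
theorem mem_cmTypes (T : ℕ) : T ∈ Γ.cmTypes ↔ Γ.isCMType T = true := by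
  simp only [cmTypes, List.mem_filter, List.mem_range, and_iff_right_iff_imp]
  intro h
  exact Γ.lt_of_isCMType h

/-- Membership in `faces`: a CM type and an ordered pair of distinct places. -/
theorem mem_faces (f : ℕ × ℕ × ℕ) :
    f ∈ Γ.faces ↔ f.1 ∈ Γ.cmTypes ∧ f.2.1 ∈ Γ.places ∧ f.2.2 ∈ Γ.places ∧ f.2.2 ≠ f.2.1 := by
  obtain ⟨T, p, q⟩ := f
  simp only [faces, List.mem_flatMap, List.mem_map, List.mem_filter, bne_iff_ne, ne_eq, Prod.mk.injEq]
  constructor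
  · rintro ⟨T', hT', p', hp', q', ⟨hq', hqp⟩, rfl, rfl, rfl⟩
    exact ⟨hT', hp', hq', hqp⟩
  · rintro ⟨hT, hp, hq, hqp⟩
    exact ⟨T, hT, p, hp, q, ⟨hq, hqp⟩, rfl, rfl, rfl⟩

/-- Two distinct places are disjoint. -/
theorem not_mem_both_places (hΓ : Γ.isCMGaloisType = true) {a b i : Fin n} (hab : Γ.placeMask a ≠ Γ.placeMask b)
    (ha : mem i (Γ.placeMask a) = true) (hb : mem i (Γ.placeMask b) = true) : False :=
  hab ((Γ.placeMask_eq_of_mem hΓ ha).symm.trans (Γ.placeMask_eq_of_mem hΓ hb))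

end CMGaloisType

end Summit.Ventures.HodgeRepro.FaceCensus
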